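import Literature.NumberTheory.Sieve.PolynomialCongruences
import Literature.NumberTheory.Sieve.IwaniecAlmostPrimesQuadratic
import Literature.NumberTheory.Sieve.BatemanHornProofs
import Summits.Parity.BatemanHorn.Theorems.RoughValueTransportDefs
import HarnessLib

/-!
# Route `RoughValueTransport`, crux `BalancedSemiprimeLayer` (stmt-Parity-9469), line
# `smooth-modulus-twisted-hooley`: the quadratic dictionary (`stub_quadraticDictionary`)

The elementary half ("dictionary"/majorant) of the quadratic case of the line: for a QUADRATIC
coordinate `g = fᵢ` of a Bateman–Horn system `f`, `0 < δ ≤ 1/4`, `0 < c ≤ 1/4` and `x` large,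
the coordinate layer `E_{f,i}(x, δ) = coordLayer f i δ x` (the `1 ≤ n ≤ x` jointly rough to the
crux's depth whose `i`-th value is not prime) satisfies

`coordLayer f i δ x ≤ 2 + #(pairFamily f i δ c x)`.

Proof.  Write `g = aX² + bX + c₀` (`a = lc g > 0`; `g` irreducible ⇒ `disc g ≠ 0`
(`Iwaniec1978.disc_ne_zero`), so the bad modulus `B = |2a·disc g| ≥ 1`).  For `n` in the layer,
`g(n) > 0` is free of primes `< x^{2(1−δ)/2} = x^{1−δ}` and not prime.  If `g(n) = 1` — at most
the `≤ 2` integer roots of `g − 1` — we book it in the "`2 +`".  Otherwise `p₁ := minFac g(n)` is a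
prime with `p₁ ∣ g(n)`, `p₁² ≤ g(n) ≤ (a+|b|+|c₀|) x² ≤ x^{2δ}·x² = (x^{1+δ})²` (eventually), and
`p₁ ≥ ⌈x^{1−δ}⌉ > B` (eventually), so `p₁ ∈ quadWindow δ x = [x^{1−δ}, x^{1+δ}]` and
`(p₁, B) = 1`; every `fⱼ(n)` is `x^c`-rough since `c ≤ 1/4 ≤ 3/8 ≤ deg fⱼ (1−δ)/2`.  Hence
`n ↦ (n, p₁)` injects the rest of the layer into `pairFamily f i δ c x`.

BOTH balanced primes are relaxed (`p₁ ↦ m` any divisor in the window, coprime to `B`; the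
cofactor's primality dropped) — legal because the crux is an UPPER bound; the sieve half
(`stub_quadraticSieve`) bounds `#pairFamily`.

References: the line card `Cruxes/BalancedSemiprimeLayer/Lines/smooth-modulus-twisted-hooley.md`;
H. Iwaniec, Invent. Math. 47 (1978) §2 (the size bound `|G(n)| ≤ (a+|b|+|c|)x²`, reused as
`Iwaniec1978.gAbs_le`).
-/

noncomputable section

open Polynomial Filter Finset
open Literature.NumberTheory.Sieve

namespace Summit.Parity.BatemanHorn.Cruxes.BalancedSemiprimeLayer.SmoothModulusTwistedHooley

/-- A polynomial of degree `2` is the quadratic `quadPoly a b c = C a * X ^ 2 + C b * X + C c` of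
its three coefficients. [folklore] -/
private theorem eq_quadPoly_of_natDegree_eq_two {g : ℤ[X]} (hg : g.natDegree = 2) :
    g = Iwaniec1978.quadPoly (g.coeff 2) (g.coeff 1) (g.coeff 0) := by
  conv_lhs => rw [g.as_sum_range_C_mul_X_pow' (n := 3) (by omega)]
  simp only [Finset.sum_range_succ, Finset.sum_range_zero, zero_add, pow_zero, mul_one, pow_one,
    Iwaniec1978.quadPoly]
  ring

/-- At most two naturals `n` of any finset have `g(n) = 1` when `deg g = 2`: they are roots of
`g − 1`, which has at most `deg g = 2` roots (`Polynomial.card_roots_sub_C'`). [folklore] -/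
private theorem card_filter_eval_eq_one_le_two {g : ℤ[X]} (hg : g.natDegree = 2) (s : Finset ℕ) :
    #(s.filter (fun n : ℕ => g.eval (n : ℤ) = 1)) ≤ 2 := by
  have hdeg : 0 < g.degree := by
    rw [Polynomial.degree_eq_natDegree (by rintro rfl; simp at hg)]
    exact_mod_cast (by omega : 0 < g.natDegree)
  calc #(s.filter (fun n : ℕ => g.eval (n : ℤ) = 1))
      ≤ #((g - C 1).roots.toFinset) := by
        refine Finset.card_le_card_of_injOn (fun n : ℕ => (n : ℤ)) ?_ ?_
        · intro n hn
          rw [Finset.mem_coe, Finset.mem_filter] at hn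
          rw [Finset.mem_coe, Multiset.mem_toFinset, Polynomial.mem_roots_sub_C hdeg]
          exact hn.2
        · exact Nat.cast_injective.injOn
    _ ≤ Multiset.card (g - C 1).roots := Multiset.toFinset_card_le _
    _ ≤ g.natDegree := Polynomial.card_roots_sub_C' hdeg
    _ = 2 := hg

/-- Splitting a finset by a predicate: if at most `2` members satisfy `p` and the others are at
most `#T` in number, then `#S ≤ 2 + #T`. [folklore] -/
private theorem card_le_two_add_card {α β : Type*} {S : Finset α} {T : Finset β} (p : α → Prop)
    [DecidablePred p] (h₁ : #(S.filter p) ≤ 2) (h₂ : #(S.filter fun a => ¬ p a) ≤ #T) :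
    #S ≤ 2 + #T := by
  rw [← Finset.card_filter_add_card_filter_not p]
  exact add_le_add h₁ h₂

/-- **The dictionary, pointwise.**  Let `g = fᵢ` be a quadratic coordinate of a Bateman–Horn
system, `δ ≤ 1/4`, `c ≤ 1/4`, and let `x` be so large that `B = |2a·disc g| < x^{1−δ}` and
`a + |b| + |c₀| ≤ x^{2δ}`.  If `1 ≤ n ≤ x` is jointly rough to the crux's depth (every `fⱼ(n) > 0`
and free of primes `< x^{deg fⱼ (1−δ)/2}`), `g(n)` is not prime and `g(n) ≠ 1`, then
`(n, minFac g(n)) ∈ pairFamily f i δ c x`: `p₁ = minFac g(n)` is a prime divisor of `g(n)` with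
`x^{1−δ} ≤ p₁` (roughness), `p₁² ≤ g(n) ≤ (a+|b|+|c₀|)x² ≤ (x^{1+δ})²`, `p₁ > B` so `(p₁, B) = 1`,
and every `fⱼ(n)` is `x^c`-rough because `c ≤ 1/4 ≤ 3/8 ≤ deg fⱼ (1−δ)/2`. [folklore] -/
theorem mk_minFac_mem_pairFamily_of_coordLayer {k : ℕ} {f : Fin k → ℤ[X]}
    (hf : IsBatemanHornSystem f) {i : Fin k} (hdeg : (f i).natDegree = 2) {δ c : ℝ}
    (hδ4 : δ ≤ 1 / 4) (hc4 : c ≤ 1 / 4) {x : ℕ}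
    (hxB : ((2 * (f i).coeff 2 *
      discrim ((f i).coeff 2) ((f i).coeff 1) ((f i).coeff 0)).natAbs : ℝ) < (x : ℝ) ^ (1 - δ))
    (hxA : (Iwaniec1978.sizeK ((f i).coeff 2) ((f i).coeff 1) ((f i).coeff 0) : ℝ) ≤
      (x : ℝ) ^ (2 * δ))
    {n : ℕ} (hn : n ∈ Icc 1 x)
    (hrough : ∀ j, 0 < (f j).eval (n : ℤ) ∧
      ∀ p ∈ range ⌈(x : ℝ) ^ (((f j).natDegree : ℝ) * (1 - δ) / 2)⌉₊,
        p.Prime → ¬ ((p : ℤ) ∣ (f j).eval (n : ℤ)))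
    (hnp : ¬ ((f i).eval (n : ℤ)).toNat.Prime) (h1 : (f i).eval (n : ℤ) ≠ 1) :
    (n, ((f i).eval (n : ℤ)).toNat.minFac) ∈ pairFamily f i δ c x := by
  set a := (f i).coeff 2
  set b := (f i).coeff 1
  set c₀ := (f i).coeff 0
  -- the coordinate as an explicit quadratic; its invariants
  have hgq : f i = Iwaniec1978.quadPoly a b c₀ := eq_quadPoly_of_natDegree_eq_two hdeg
  have ha : 0 < a := by
    have h := hf.leadingCoeff_pos i
    rwa [Polynomial.leadingCoeff, hdeg] at h
  have hirr : Irreducible (Iwaniec1978.quadPoly a b c₀) := hgq ▸ hf.irreducible i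
  have hdisc : discrim a b c₀ ≠ 0 := Iwaniec1978.disc_ne_zero ha.ne' hirr
  have hB0 : (2 * a * discrim a b c₀).natAbs ≠ 0 := by
    rw [Int.natAbs_ne_zero]
    exact mul_ne_zero (mul_ne_zero two_ne_zero ha.ne') hdisc
  -- the range of `n`
  rw [mem_Icc] at hn
  obtain ⟨hn1, hnx⟩ := hn
  have hx1 : (1 : ℝ) ≤ x := by exact_mod_cast hn1.trans hnx
  have hxpos : (0 : ℝ) < x := by linarith
  have hnx' : (n : ℝ) ≤ x := by exact_mod_cast hnx
  -- the value `v = g(n) > 0`, `m₀ = v` as a natural, `p₁ = minFac m₀`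
  have hv_pos : 0 < (f i).eval (n : ℤ) := (hrough i).1
  have hm₀ : ((((f i).eval (n : ℤ)).toNat : ℕ) : ℤ) = (f i).eval (n : ℤ) :=
    Int.toNat_of_nonneg hv_pos.le
  have hm₀1 : ((f i).eval (n : ℤ)).toNat ≠ 1 := by omega
  have hm₀pos : 0 < ((f i).eval (n : ℤ)).toNat := by omega
  have hp₁ : ((f i).eval (n : ℤ)).toNat.minFac.Prime := Nat.minFac_prime hm₀1
  have hp₁sq : ((f i).eval (n : ℤ)).toNat.minFac ^ 2 ≤ ((f i).eval (n : ℤ)).toNat :=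
    Nat.minFac_sq_le_self hm₀pos hnp
  have hp₁v : ((((f i).eval (n : ℤ)).toNat.minFac : ℕ) : ℤ) ∣ (f i).eval (n : ℤ) := by
    rw [← hm₀]
    exact Int.natCast_dvd_natCast.mpr (Nat.minFac_dvd _)
  -- roughness of `g(n)` at level `x^{2(1-δ)/2} = x^{1-δ}`: `p₁ ≥ ⌈x^{1-δ}⌉`
  have hexp : (((f i).natDegree : ℝ) * (1 - δ) / 2) = 1 - δ := by
    rw [hdeg]; push_cast; ring
  have hceil : ⌈(x : ℝ) ^ (1 - δ)⌉₊ ≤ ((f i).eval (n : ℤ)).toNat.minFac := by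
    refine not_lt.mp fun hlt => (hrough i).2 _ ?_ hp₁ hp₁v
    rw [mem_range, hexp]
    exact hlt
  have hp₁ge : (x : ℝ) ^ (1 - δ) ≤ (((f i).eval (n : ℤ)).toNat.minFac : ℝ) :=
    (Nat.le_ceil _).trans (by exact_mod_cast hceil)
  -- size: `p₁² ≤ g(n) ≤ (a+|b|+|c₀|) x² ≤ x^{2δ} x² = (x^{1+δ})²`
  have hvle : ((((f i).eval (n : ℤ)).toNat : ℕ) : ℝ) ≤
      (Iwaniec1978.sizeK a b c₀ : ℝ) * (x : ℝ) ^ 2 := by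
    have h := Iwaniec1978.gAbs_le (b := b) (c := c₀) (n := n) ha hx1 hnx'
    have hgabs : Iwaniec1978.gAbs a b c₀ n = ((f i).eval (n : ℤ)).toNat := by
      have h' : (f i).eval (n : ℤ) = a * (n : ℤ) ^ 2 + b * n + c₀ := by
        rw [hgq, Iwaniec1978.eval_quadPoly]
      unfold Iwaniec1978.gAbs
      rw [← h']
      omega
    rwa [hgabs] at h
  have hp₁le : (((f i).eval (n : ℤ)).toNat.minFac : ℝ) ≤ (x : ℝ) ^ (1 + δ) := by
    have h2 : (((f i).eval (n : ℤ)).toNat.minFac : ℝ) ^ 2 ≤ ((x : ℝ) ^ (1 + δ)) ^ 2 := by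
      calc (((f i).eval (n : ℤ)).toNat.minFac : ℝ) ^ 2
            ≤ ((((f i).eval (n : ℤ)).toNat : ℕ) : ℝ) := by exact_mod_cast hp₁sq
        _ ≤ (Iwaniec1978.sizeK a b c₀ : ℝ) * (x : ℝ) ^ 2 := hvle
        _ ≤ (x : ℝ) ^ (2 * δ) * (x : ℝ) ^ 2 := by gcongr
        _ = ((x : ℝ) ^ (1 + δ)) ^ 2 := by
            rw [← Real.rpow_natCast ((x : ℝ) ^ (1 + δ)), ← Real.rpow_mul hxpos.le,
              ← Real.rpow_natCast (x : ℝ), ← Real.rpow_add hxpos]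
            norm_num
            ring_nf
    exact (pow_le_pow_iff_left₀ (by positivity) (by positivity) two_ne_zero).mp h2
  -- membership
  rw [mem_pairFamily]
  refine ⟨⟨mem_Icc.mpr ⟨hn1, hnx⟩, ?_⟩, ?_, hp₁v, ?_⟩
  · -- the window
    unfold quadWindow
    rw [mem_Icc]
    exact ⟨hceil, Nat.le_floor hp₁le⟩
  · -- every `fⱼ(n)` is `x^c`-rough: `c ≤ deg fⱼ (1-δ)/2`
    intro j
    refine ⟨(hrough j).1, fun p hp hpp => (hrough j).2 p ?_ hpp⟩
    rw [mem_range] at hp ⊢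
    refine lt_of_lt_of_le hp (Nat.ceil_mono ?_)
    refine Real.rpow_le_rpow_of_exponent_le hx1 ?_
    have hd : (1 : ℝ) ≤ (f j).natDegree := by exact_mod_cast hf.natDegree_pos j
    nlinarith
  · -- `(p₁, B) = 1`: `p₁` is a prime `> B ≥ 1`
    rw [Nat.Prime.coprime_iff_not_dvd hp₁]
    intro hdvd
    have hle : (((f i).eval (n : ℤ)).toNat.minFac : ℝ) ≤ ((2 * a * discrim a b c₀).natAbs : ℝ) := by
      exact_mod_cast Nat.le_of_dvd (Nat.pos_of_ne_zero hB0) hdvd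
    linarith

/-- **stub_quadraticDictionary** (registered stub of the skeleton
`Cruxes/BalancedSemiprimeLayer/Lines/smooth-modulus-twisted-hooley.lean`, reshape r1; elementary).
For a QUADRATIC coordinate `g = fᵢ` of a Bateman–Horn system, `0 < δ ≤ 1/4`, `0 < c ≤ 1/4` and
`x` large, every `n` of the layer `E_{f,i}(x, δ)`, except the `≤ 2` roots of `g − 1`, has `g(n)`
composite, positive and free of primes `< x^{1−δ}`, so `p₁ := minFac g(n)` satisfies
`x^{1−δ} ≤ p₁ ≤ x^{1+δ}`, `p₁ ∣ g(n)`, `(p₁, B_g) = 1`, and every `fⱼ(n)` is `x^c`-rough; hence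
`n ↦ (n, p₁)` injects the layer minus two points into `pairFamily f i δ c x`:
`coordLayer f i δ x ≤ 2 + #(pairFamily f i δ c x)` eventually.  "Eventually" = `x^{1−δ} > B_g` and
`x^{2δ} ≥ a + |b| + |c₀|`. [folklore] -/
theorem stub_quadraticDictionary :
    ∀ (k : ℕ) (f : Fin k → ℤ[X]), IsBatemanHornSystem f → ∀ i : Fin k, (f i).natDegree = 2 →
      ∀ δ c : ℝ, 0 < δ → δ ≤ 1 / 4 → 0 < c → c ≤ 1 / 4 →
        ∀ᶠ x : ℕ in atTop, coordLayer f i δ x ≤ 2 + #(pairFamily f i δ c x) := by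
  intro k f hf i hdeg δ c hδ hδ4 _ hc4
  have hB : ∀ᶠ x : ℕ in atTop, ((2 * (f i).coeff 2 *
      discrim ((f i).coeff 2) ((f i).coeff 1) ((f i).coeff 0)).natAbs : ℝ) < (x : ℝ) ^ (1 - δ) :=
    ((tendsto_rpow_atTop (by linarith)).comp tendsto_natCast_atTop_atTop).eventually_gt_atTop _
  have hA : ∀ᶠ x : ℕ in atTop,
      (Iwaniec1978.sizeK ((f i).coeff 2) ((f i).coeff 1) ((f i).coeff 0) : ℝ) ≤ (x : ℝ) ^ (2 * δ) :=
    ((tendsto_rpow_atTop (by linarith)).comp tendsto_natCast_atTop_atTop).eventually_ge_atTop _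
  filter_upwards [hB, hA] with x hxB hxA
  unfold coordLayer
  refine card_le_two_add_card (fun n : ℕ => (f i).eval (n : ℤ) = 1)
    (card_filter_eval_eq_one_le_two hdeg _) ?_
  refine Finset.card_le_card_of_injOn (fun n : ℕ => (n, ((f i).eval (n : ℤ)).toNat.minFac)) ?_ ?_
  · intro n hn
    rw [Finset.mem_coe, mem_filter, mem_filter] at hn
    obtain ⟨⟨hnI, hrough, hnp⟩, h1⟩ := hn
    exact mk_minFac_mem_pairFamily_of_coordLayer hf hdeg hδ4 hc4 hxB hxA hnI hrough hnp h1
  · intro a _ b _ h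
    exact congrArg Prod.fst h

end Summit.Parity.BatemanHorn.Cruxes.BalancedSemiprimeLayer.SmoothModulusTwistedHooley
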